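import Summits.AnomalousDissipation.AnomalousDissipation.Theorems.SolenoidalFractalHomogenisationCubatureMoments
import Summits.AnomalousDissipation.AnomalousDissipation.Theorems.SolenoidalFractalHomogenisationPermissibleFractalCarrierBookkeeping
import HarnessLib

/-!
# K2R `RealisedQuasiStaticCellLaw`, line `floquet-bloch`, stub `stub_lowSectorWeakNear`: isotropy is preserved by stretching
# the slot durations (helper; `--supports stmt-AnomalousDissipation-20446`)

Summits-side helper file (everything proved; no definitions, no named facts). `LatticeWord.stretch` multiplies every slot
duration and hence the period by `s`; the slot gain is linear in the duration, so `IsotropicWordGain W c₀` implies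
`IsotropicWordGain (W.stretch s hs) c₀` with the SAME Taylor constant (`isotropicWordGain_stretch`). In particular the replayed
cell word `(cubatureWord.stretch M).stretch (1/ν)` of the K2R crux is isotropic with constant `c0` — the input `hW` of
`isoSector_decay_of_rates` (p595074) at the cell.
-/

set_option linter.dupNamespace false

noncomputable section

namespace Summit.AnomalousDissipation.AnomalousDissipation.Theorems.SolenoidalFractalHomogenisation.RealisedQuasiStaticCellLaw

open scoped InnerProductSpace
open Literature.Analysis Literature.Analysis.FunctionSpaces Literature.Analysis.FunctionSpaces.Torus
open Literature.Analysis.FluidPDE Literature.Analysis.FluidPDE.LatticeShear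

/-- The slot gain of a stretched slot is the stretched slot gain. -/
theorem slotGain_stretch {k : ℕ} (W : LatticeWord k) (s : ℝ) (hs : 0 < s) (j : Fin k)
    (q p : EuclideanSpace ℝ (Fin 3)) :
    slotGain ((W.stretch s hs).phase j) q p = s * slotGain (W.phase j) q p := by
  obtain ⟨hm, he, -, hτ, -⟩ := LatticeWord_stretch_phase W s hs j
  unfold slotGain
  simp only [hm, he, hτ]
  ring

/-- **Isotropy is preserved by stretching** (same Taylor constant). -/
theorem isotropicWordGain_stretch {k : ℕ} {W : LatticeWord k} {c₀ : ℝ} (hW : IsotropicWordGain W c₀) (s : ℝ)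
    (hs : 0 < s) : IsotropicWordGain (W.stretch s hs) c₀ := by
  intro q p hq hp hpq
  have h := hW q p hq hp hpq
  simp only [slotGain_stretch]
  rw [← Finset.mul_sum, h, PermissibleCarrier.period_stretch]
  ring

/-- The replayed cell word of the K2R crux is isotropic with constant `c0`. -/
theorem isotropicWordGain_cellWord {M ν : ℝ} (hM : 0 < M) (hν : 0 < 1 / ν) :
    IsotropicWordGain ((cubatureWord.stretch M hM).stretch (1 / ν) hν) c0 :=
  isotropicWordGain_stretch (isotropicWordGain_stretch isotropicWordGain_cubatureWord M hM) (1 / ν) hν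

end Summit.AnomalousDissipation.AnomalousDissipation.Theorems.SolenoidalFractalHomogenisation.RealisedQuasiStaticCellLaw

end
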